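import Literature.MathematicalPhysics.QuantumFieldTheory.MassGapFromDiagonalClustering
import HarnessLib

/-!
# The full-spectrum mass gap of OS data from diagonal bounds along an ARITHMETIC PROGRESSION of times

Topic `MathematicalPhysics/QuantumFieldTheory` (families `constructive-qft`, `yang-mills`); theorem-only
sequel of `OSTransferSelfImprovement` / `MassGapFromDiagonalClustering`.

`OSData.hasMassGap_of_diagBound` reduces Jaffe–Witten's full-spectrum gap `T.HasMassGap Δ` to a
DIAGONAL exponential bound with a free constant for every single slab-ordered real product tensor `P`,
required there for ALL times `t ≥ 0`.  This file shows that the bound is only needed along the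
arithmetic progression `t ∈ t₀ℕ` of ANY step `t₀ > 0`:

* `OSReconstructionNoE1.re_inner_transfer_self_antitone` — `t ↦ ⟨ψ, e^{−tH}ψ⟩` is non-increasing on
  `[0, ∞)` (`⟨ψ, e^{−tH}ψ⟩ = ‖e^{−tH/2}ψ‖²`, semigroup law, contraction);
* `OSReconstructionNoE1.re_inner_transfer_self_le_of_le_exp_on` — self-improvement of the constant
  (`C ↦ ‖ψ‖²`) from a bound on any set of non-negative times closed under doubling (the doubly
  exponential iteration of Osterwalder–Schrader (4.9) along `t, 2t, 4t, …` never leaves the set);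
* `OSReconstructionNoE1.re_inner_transfer_self_le_of_progression` — a bound `C e^{−Δ j t₀}` along
  `j ∈ ℕ` gives `⟨ψ, e^{−tH}ψ⟩ ≤ ‖ψ‖² e^{−Δt}` for ALL `t ≥ 0` (improve on the progression, step down
  to `⌊t/t₀⌋ t₀` by monotonicity at the cost of a factor `e^{|Δ| t₀}`, improve once more);
* `OSData.hasMassGap_of_diagBound_progression` — hence diagonal bounds with free constants along
  `t₀ℕ` give `T.HasMassGap Δ` (`d ≥ 2`);
* lattice-facing forms `OSData.hasMassGap_of_tendsto_of_diagBound_progression` and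
  `IsYangMillsFor.hasMassGap_of_diagClustering_progression`: a lattice approximation converging on
  off-diagonal real product tensors needs to cluster (diagonally, free constants, slack `ε`,
  eventually in `k`) only at the physical times `j t₀` — e.g. the times a scheme with spacings
  commensurable to `t₀` (`t₀ ∈ a_k ℕ` eventually) reaches by EXACT lattice translations, so that no
  density of reachable times and no `M`-adic shape of the spacings is required.

Spectrally: `⟨ψ, e^{−tH}ψ⟩ = ∫ e^{−λt} dμ_ψ(λ)` and a bound `C e^{−Δ t_j}` along any `t_j → ∞` already
forces `μ_ψ([0, Δ)) = 0`; the progression form is the one provable from log-convexity and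
monotonicity alone, without the spectral theorem.

References: K. Osterwalder, R. Schrader, CMP 31 (1973) §4.1 (4.7)–(4.9) [OsterwalderSchraderCMP1973];
J. Glimm, A. Jaffe, *Quantum Physics* (1987) §6.1 Thm. 6.1.3 [GlimmJaffeQP1987];
K. Osterwalder, E. Seiler, Ann. Phys. 110 (1978) §§2–4 [OsterwalderSeiler1978].
Tree: `re_inner_transfer_self_le_of_le_exp`, `inner_transfer_self_eq`, `transfer_add`,
`norm_transfer_le`, `hasMassGap_of_diagBound`, `le_of_sq_le_mul_succ_of_le_mul_pow`.
-/

open scoped SchwartzMap ComplexConjugate InnerProductSpace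
open Filter Topology Complex Set
open Literature.MathematicalPhysics.AQFT Literature.MathematicalPhysics.QuantumLattice

noncomputable section

namespace Literature.MathematicalPhysics.QuantumFieldTheory

universe u

/-! ### Monotonicity and self-improvement along doubling-closed sets of times -/

namespace OSReconstructionNoE1

variable {ι : Type u} {d : ℕ} [NeZero d] {S : LabelledSchwingerFamily ι (EuclideanSpace ℝ (Fin d))}
variable (h : OSReconstructionNoE1 S)

/-- **Monotonicity**: `Re ⟨ψ, e^{-tH} ψ⟩ ≤ Re ⟨ψ, e^{-sH} ψ⟩` for `0 ≤ s ≤ t` — since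
`⟨ψ, e^{-tH}ψ⟩ = ‖e^{-tH/2}ψ‖²`, `e^{-tH/2} = e^{-(t-s)H/2} e^{-sH/2}` and `e^{-(t-s)H/2}` is a contraction.
[cite: GlimmJaffeQP1987, §6.1 Thm. 6.1.3] -/
theorem re_inner_transfer_self_antitone {s t : ℝ} (hs : 0 ≤ s) (hst : s ≤ t) (ψ : h.Hilbert) :
    (⟪ψ, h.transfer t ψ⟫_ℂ).re ≤ (⟪ψ, h.transfer s ψ⟫_ℂ).re := by
  rw [h.inner_transfer_self_eq (hs.trans hst), h.inner_transfer_self_eq hs, Complex.ofReal_re,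
    Complex.ofReal_re]
  have ht2 : t / 2 = (t - s) / 2 + s / 2 := by ring
  rw [ht2, h.transfer_add (by linarith) (by linarith), ContinuousLinearMap.comp_apply]
  exact pow_le_pow_left₀ (norm_nonneg _) (h.norm_transfer_le _ _) 2

/-- **Self-improvement of the constant on a doubling-closed set of times**: if `D ⊆ [0, ∞)` is closed
under `t ↦ 2t` and `Re ⟨ψ, e^{-tH} ψ⟩ ≤ C e^{-Δt}` for `t ∈ D` with SOME constant `C`, then
`Re ⟨ψ, e^{-tH} ψ⟩ ≤ ‖ψ‖² e^{-Δt}` for `t ∈ D` (the iteration of `(Re⟨ψ,e^{-tH}ψ⟩)² ≤ ‖ψ‖² Re⟨ψ,e^{-2tH}ψ⟩`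
along `t, 2t, 4t, … ∈ D`). [cite: OsterwalderSchraderCMP1973, §4.1 eqs. (4.8)–(4.9)] -/
theorem re_inner_transfer_self_le_of_le_exp_on {ψ : h.Hilbert} {Δ C : ℝ} {D : Set ℝ}
    (hD0 : ∀ t ∈ D, 0 ≤ t) (hD2 : ∀ t ∈ D, 2 * t ∈ D)
    (hC : ∀ t ∈ D, (⟪ψ, h.transfer t ψ⟫_ℂ).re ≤ C * Real.exp (-Δ * t))
    {t : ℝ} (htD : t ∈ D) :
    (⟪ψ, h.transfer t ψ⟫_ℂ).re ≤ ‖ψ‖ ^ 2 * Real.exp (-Δ * t) := by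
  -- adapted from `re_inner_transfer_self_le_of_le_exp` (all times) — the doubling never leaves `D`
  have ht : 0 ≤ t := hD0 t htD
  have hmem : ∀ n : ℕ, 2 ^ n * t ∈ D := fun n => by
    induction n with
    | zero => simpa using htD
    | succ n ih =>
      have := hD2 _ ih
      rwa [pow_succ, mul_comm ((2 : ℝ) ^ n) 2, mul_assoc]
  set a : ℕ → ℝ := fun n => (⟪ψ, h.transfer (2 ^ n * t) ψ⟫_ℂ).re * Real.exp (Δ * (2 ^ n * t))
    with ha
  have hsq : ∀ n, a n ^ 2 ≤ ‖ψ‖ ^ 2 * a (n + 1) := fun n => by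
    have h2t : (2 : ℝ) ^ (n + 1) * t = 2 * (2 ^ n * t) := by rw [pow_succ]; ring
    have hexp : Real.exp (Δ * (2 ^ n * t)) ^ 2 = Real.exp (Δ * (2 ^ (n + 1) * t)) := by
      rw [← Real.exp_nat_mul, h2t]; push_cast; ring_nf
    have h1 := h.re_inner_transfer_self_sq_le (t := 2 ^ n * t) (by positivity) ψ
    simp only [ha]
    rw [mul_pow, hexp, h2t]
    have h0 : 0 ≤ Real.exp (Δ * (2 * (2 ^ n * t))) := (Real.exp_pos _).le
    rw [show (2 : ℝ) * (2 ^ n * t) = 2 ^ (n + 1) * t from h2t.symm] at h1 h0 ⊢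
    nlinarith [mul_le_mul_of_nonneg_right h1 h0]
  have hbdd : ∀ n, a n ≤ max C 0 * (1 : ℝ) ^ n := fun n => by
    rw [one_pow, mul_one]
    have h1 := hC (2 ^ n * t) (hmem n)
    have h0 : 0 ≤ Real.exp (Δ * (2 ^ n * t)) := (Real.exp_pos _).le
    calc a n ≤ C * Real.exp (-Δ * (2 ^ n * t)) * Real.exp (Δ * (2 ^ n * t)) :=
          mul_le_mul_of_nonneg_right h1 h0
      _ = C := by rw [mul_assoc, ← Real.exp_add]; simp
      _ ≤ max C 0 := le_max_left _ _
  have key := le_of_sq_le_mul_succ_of_le_mul_pow (sq_nonneg ‖ψ‖) le_rfl hbdd hsq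
  have ha0 : a 0 = (⟪ψ, h.transfer t ψ⟫_ℂ).re * Real.exp (Δ * t) := by
    simp [ha]
  rw [ha0] at key
  calc (⟪ψ, h.transfer t ψ⟫_ℂ).re
      = (⟪ψ, h.transfer t ψ⟫_ℂ).re * Real.exp (Δ * t) * Real.exp (-Δ * t) := by
          rw [mul_assoc, ← Real.exp_add]; simp
    _ ≤ ‖ψ‖ ^ 2 * Real.exp (-Δ * t) := mul_le_mul_of_nonneg_right key (Real.exp_pos _).le

/-- **An arithmetic progression of times suffices**: if `Re ⟨ψ, e^{-j t₀ H} ψ⟩ ≤ C e^{-Δ j t₀}` for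
all `j ∈ ℕ` (`t₀ > 0`, any constant `C`), then `Re ⟨ψ, e^{-tH} ψ⟩ ≤ ‖ψ‖² e^{-Δt}` for ALL `t ≥ 0`:
improve the constant on the (doubling-closed) progression, step down from `t` to `⌊t/t₀⌋ t₀` by
monotonicity (factor `e^{|Δ| t₀}`), and improve once more with infinite horizon.
[cite: OsterwalderSchraderCMP1973, §4.1 eqs. (4.7)–(4.9)] [cite: GlimmJaffeQP1987, §6.1 Thm. 6.1.3] -/
theorem re_inner_transfer_self_le_of_progression {ψ : h.Hilbert} {Δ C t₀ : ℝ} (ht₀ : 0 < t₀)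
    (hC : ∀ j : ℕ, (⟪ψ, h.transfer (j * t₀) ψ⟫_ℂ).re ≤ C * Real.exp (-Δ * (j * t₀)))
    {t : ℝ} (ht : 0 ≤ t) :
    (⟪ψ, h.transfer t ψ⟫_ℂ).re ≤ ‖ψ‖ ^ 2 * Real.exp (-Δ * t) := by
  -- (1) the improved bound on the progression
  have hprog : ∀ j : ℕ, (⟪ψ, h.transfer (j * t₀) ψ⟫_ℂ).re ≤ ‖ψ‖ ^ 2 * Real.exp (-Δ * (j * t₀)) := by
    intro j
    refine h.re_inner_transfer_self_le_of_le_exp_on (D := Set.range fun j : ℕ => (j : ℝ) * t₀)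
      (C := C) ?_ ?_ ?_ ⟨j, rfl⟩
    · rintro _ ⟨i, rfl⟩; positivity
    · rintro _ ⟨i, rfl⟩; exact ⟨2 * i, by push_cast; ring⟩
    · rintro _ ⟨i, rfl⟩; exact hC i
  -- (2) all times, constant `‖ψ‖² e^{|Δ| t₀}`, by monotonicity
  have hall : ∀ s : ℝ, 0 ≤ s →
      (⟪ψ, h.transfer s ψ⟫_ℂ).re ≤ ‖ψ‖ ^ 2 * Real.exp (|Δ| * t₀) * Real.exp (-Δ * s) := by
    intro s hs
    set j : ℕ := ⌊s / t₀⌋₊ with hj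
    have hj1 : (j : ℝ) * t₀ ≤ s := by
      have := Nat.floor_le (div_nonneg hs ht₀.le)
      rw [← hj] at this
      exact (mul_le_mul_of_nonneg_right this ht₀.le).trans_eq (div_mul_cancel₀ s ht₀.ne')
    have hj2 : s < (j : ℝ) * t₀ + t₀ := by
      have := Nat.lt_floor_add_one (s / t₀)
      rw [← hj] at this
      have h2 := mul_lt_mul_of_pos_right this ht₀
      rw [div_mul_cancel₀ s ht₀.ne'] at h2
      linarith
    have hmono := h.re_inner_transfer_self_antitone (by positivity) hj1 ψ
    refine hmono.trans ((hprog j).trans ?_)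
    rw [mul_assoc, ← Real.exp_add]
    refine mul_le_mul_of_nonneg_left (Real.exp_le_exp.2 ?_) (sq_nonneg _)
    have h1 : -Δ * (j * t₀) = -Δ * s + Δ * (s - j * t₀) := by ring
    rw [h1]
    have h2 : Δ * (s - j * t₀) ≤ |Δ| * t₀ := by
      have h3 : Δ * (s - j * t₀) ≤ |Δ| * (s - j * t₀) :=
        mul_le_mul_of_nonneg_right (le_abs_self Δ) (by linarith)
      have h4 : |Δ| * (s - j * t₀) ≤ |Δ| * t₀ :=
        mul_le_mul_of_nonneg_left (by linarith) (abs_nonneg Δ)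
      linarith
    linarith
  -- (3) self-improvement with infinite horizon
  exact h.re_inner_transfer_self_le_of_le_exp hall ht

end OSReconstructionNoE1

/-! ### The full-spectrum gap from diagonal bounds along a progression -/

namespace OSData

variable {ι : Type} {d : ℕ} [NeZero d]

/-- **Full-spectrum gap from DIAGONAL bounds along an arithmetic progression of times** (`d ≥ 2`).
If `t₀ > 0` and for every arity `n ≥ 1`, every label string `k` and every slab-ordered real product
tensor `P` there is SOME constant `C` with
`‖𝔖₂ₙ^{rev k ++ k}(ΘP* ⊗ T_{j t₀} P) − 𝔖ₙ^{rev k}(ΘP*) 𝔖ₙ^{k}(P)‖ ≤ C e^{−Δ j t₀}` for all `j ∈ ℕ`, then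
`T.HasMassGap Δ`: the diagonal quantity is `⟨v, e^{−tH} v⟩ ≥ 0` for `v = Ψ_P − ⟨Ω,Ψ_P⟩Ω`, the
progression bound improves to `‖v‖² e^{−Δt}` for all `t ≥ 0`
(`re_inner_transfer_self_le_of_progression`), and `hasMassGap_of_diagBound` concludes.
[cite: GlimmJaffeQP1987, §6.1 Thm. 6.1.3] [cite: OsterwalderSchraderCMP1973, §4.1 eqs. (4.7)–(4.9)] -/
theorem hasMassGap_of_diagBound_progression (T : OSData ι d) (hd : 1 < d) (Δ : ℝ) {t₀ : ℝ}
    (ht₀ : 0 < t₀)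
    (hdiag : ∀ (n : ℕ), n ≠ 0 → ∀ (k : Fin n → ι) (P : 𝓢((Fin n → EuclideanSpace ℝ (Fin d)), ℂ)),
      P ∈ slabOrderedProducts d n → ∃ C : ℝ, ∀ j : ℕ,
        ‖T.schwinger (n + n) (Fin.append (k ∘ Fin.rev) k)
              ((osAdjoint P).appendTensor
                (translateMulti (EuclideanSpace.single 0 ((j : ℝ) * t₀)) P)) -
            T.schwinger n (k ∘ Fin.rev) (osAdjoint P) * T.schwinger n k P‖ ≤
          C * Real.exp (-Δ * ((j : ℝ) * t₀))) :
    T.HasMassGap Δ := by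
  have hOS : OSReconstructionNoE1 T.schwinger := OSReconstructionNoE1.of_osAxioms T.osAxioms
  have h0 : T.schwinger.IsNormalized := T.normalized
  refine hasMassGap_of_diagBound T hd Δ fun n hn k P hP => ?_
  obtain ⟨C, hC⟩ := hdiag n hn k P hP
  have hPt : IsTimeOrdered P := IsTimeOrdered.of_mem_slabOrderedProducts hP
  set v : hOS.Hilbert := hOS.fieldVec n k P hPt - ⟪hOS.vacuum, hOS.fieldVec n k P hPt⟫_ℂ • hOS.vacuum
    with hv
  -- the diagonal quantity is `⟨v, e^{-tH} v⟩`, a non-negative real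
  have hid : ∀ t : ℝ, 0 ≤ t →
      T.schwinger (n + n) (Fin.append (k ∘ Fin.rev) k)
          ((osAdjoint P).appendTensor (translateMulti (EuclideanSpace.single 0 t) P)) -
        T.schwinger n (k ∘ Fin.rev) (osAdjoint P) * T.schwinger n k P = ⟪v, hOS.transfer t v⟫_ℂ := by
    intro t ht
    rw [hv, hOS.inner_proj_transfer_proj h0, hOS.inner_fieldVec_transfer_fieldVec k k hPt hPt ht,
      hOS.inner_fieldVec_vacuum, hOS.inner_vacuum_fieldVec]
  have hre : ∀ t : ℝ, 0 ≤ t → ‖⟪v, hOS.transfer t v⟫_ℂ‖ = (⟪v, hOS.transfer t v⟫_ℂ).re := fun t ht => by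
    rw [hOS.inner_transfer_self_eq ht, Complex.norm_real, Complex.ofReal_re, Real.norm_eq_abs,
      abs_of_nonneg (sq_nonneg _)]
  have hprog : ∀ j : ℕ, (⟪v, hOS.transfer (j * t₀) v⟫_ℂ).re ≤ C * Real.exp (-Δ * (j * t₀)) := by
    intro j
    have hjt : (0 : ℝ) ≤ j * t₀ := by positivity
    rw [← hre _ hjt, ← hid _ hjt]
    exact hC j
  refine ⟨‖v‖ ^ 2, fun t ht => ?_⟩
  rw [hid t ht, hre t ht]
  exact hOS.re_inner_transfer_self_le_of_progression ht₀ hprog ht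

/-- **The transfer from a lattice approximation along a progression of times.**  If `Λ k → 𝔖` on the
off-diagonal real product tensors of every degree `n ≥ 1` (the convergence clause of `IsYangMillsFor` /
`IsQCDAlong`), `t₀ > 0`, and for every arity `n ≥ 1`, label string `σ` and ONE slab-ordered real
factor datum `p` there is a constant `C` such that for all `j ∈ ℕ` and `ε > 0`, EVENTUALLY in `k`,
`‖Λᵏ₂ₙ(θpʳ ++ T_{j t₀} p) − Λᵏₙ(θpʳ) Λᵏₙ(p)‖ ≤ C e^{−Δ j t₀} + ε`, then `T.HasMassGap Δ` (`d ≥ 2`) — the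
lattice needs to cluster only at the physical times `j t₀` (those reached by exact lattice
translations when `t₀ ∈ a_k ℕ` eventually). [cite: GlimmJaffeQP1987, §6.1 Thm. 6.1.3] [cite: OsterwalderSeiler1978, §§2–4] -/
theorem hasMassGap_of_tendsto_of_diagBound_progression (T : OSData ι d) (hd : 1 < d)
    (Λ : ℕ → (n : ℕ) → (Fin n → ι) → (Fin n → 𝓢(EuclideanSpace ℝ (Fin d), ℝ)) → ℂ)
    (hΛ : ∀ (n : ℕ), n ≠ 0 → ∀ (σ : Fin n → ι) (f : Fin n → 𝓢(EuclideanSpace ℝ (Fin d), ℝ))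
      (F : 𝓢((Fin n → EuclideanSpace ℝ (Fin d)), ℂ)), IsTensorOf F (fun i => ofRealTest (f i)) →
      IsOffDiagonal F → Tendsto (fun k => Λ k n σ f) atTop (𝓝 (T.schwinger n σ F)))
    {Δ t₀ : ℝ} (ht₀ : 0 < t₀)
    (hdiag : ∀ (n : ℕ), n ≠ 0 → ∀ (σ : Fin n → ι) (p : Fin n → 𝓢(EuclideanSpace ℝ (Fin d), ℝ)),
      IsSlabOrdered p → ∃ C : ℝ, ∀ j : ℕ, ∀ ε : ℝ, 0 < ε → ∀ᶠ k in atTop,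
        ‖Λ k (n + n) (Fin.append (σ ∘ Fin.rev) σ)
              (Fin.append (fun l => thetaTest d (p (Fin.rev l)))
                (fun l => translateTest (EuclideanSpace.single 0 ((j : ℝ) * t₀)) (p l))) -
            Λ k n (σ ∘ Fin.rev) (fun l => thetaTest d (p (Fin.rev l))) * Λ k n σ p‖ ≤
          C * Real.exp (-Δ * ((j : ℝ) * t₀)) + ε) :
    T.HasMassGap Δ := by
  -- adapted from `hasMassGap_of_tendsto_of_diagBound` (all times)
  refine hasMassGap_of_diagBound_progression T hd Δ ht₀ fun n hn σ P hP => ?_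
  obtain ⟨p, hpT, hp⟩ := exists_isSlabOrdered_of_mem_slabOrderedProducts hP
  obtain ⟨C, hC⟩ := hdiag n hn σ p hp
  have hPt : IsTimeOrdered P := IsTimeOrdered.of_mem_slabOrderedProducts hP
  refine ⟨C, fun j => ?_⟩
  have ht : (0 : ℝ) ≤ j * t₀ := by positivity
  set a : EuclideanSpace ℝ (Fin d) := EuclideanSpace.single 0 ((j : ℝ) * t₀) with ha
  have hA : Tendsto (fun k => Λ k (n + n) (Fin.append (σ ∘ Fin.rev) σ)
        (Fin.append (fun l => thetaTest d (p (Fin.rev l))) (fun l => translateTest a (p l))))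
      atTop (𝓝 (T.schwinger (n + n) (Fin.append (σ ∘ Fin.rev) σ)
        ((osAdjoint P).appendTensor (translateMulti a P)))) := by
    refine hΛ (n + n) (by omega) _ _ _ ?_ ?_
    · have h1 := hpT.osAdjoint.appendTensor (hpT.translateMulti a)
      rwa [append_ofRealTest] at h1
    · exact OSReconstructionNoE1.isOffDiagonal_appendTensor_osAdjoint hPt
        (OSReconstructionNoE1.isTimeOrdered_translateMulti hPt (by simp [ha, ht]))
  have hB : Tendsto (fun k => Λ k n (σ ∘ Fin.rev) (fun l => thetaTest d (p (Fin.rev l))))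
      atTop (𝓝 (T.schwinger n (σ ∘ Fin.rev) (osAdjoint P))) :=
    hΛ n hn _ _ _ hpT.osAdjoint hPt.isOffDiagonal.osAdjoint
  have hC' : Tendsto (fun k => Λ k n σ p) atTop (𝓝 (T.schwinger n σ P)) :=
    hΛ n hn _ _ _ hpT hPt.isOffDiagonal
  have hlim := (hA.sub (hB.mul hC')).norm
  refine le_of_forall_pos_le_add fun ε hε => ?_
  exact le_of_tendsto_of_tendsto hlim tendsto_const_nhds (hC j ε hε)

end OSData

/-! ### The Yang–Mills instance -/

section YangMills

variable {G : Type} [Group G] [MeasurableSpace G] [TopologicalSpace G] [IsTopologicalGroup G]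
  [CompactSpace G] [BorelSpace G]

/-- **Continuum gap clause of Yang–Mills from DIAGONAL clustering along a progression of physical
times**: `IsYangMillsFor r sch T`, `t₀ > 0` and, for every arity `n ≥ 1`, species string `σ` and one
slab-ordered real factor datum `p`, a bound `‖Λᵏ₂ₙ(θpʳ ++ T_{j t₀} p) − Λᵏₙ(θpʳ)Λᵏₙ(p)‖ ≤ C e^{−Δ j t₀} + ε`
eventually in `k` (every `j ∈ ℕ`, `ε > 0`; `Λᵏ` the lattice `n`-point functions on the scheme's own
tori) give `T.HasMassGap Δ`.  With spacings commensurable to `t₀` the translates `T_{j t₀}` are exact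
lattice time shifts, eventually in `k`. [cite: JaffeWitten2000, §4–§5] [cite: OsterwalderSeiler1978, §§2–4] -/
theorem IsYangMillsFor.hasMassGap_of_diagClustering_progression {r : LatticeRep G}
    {sch : SpeciesScheme (YMSpecies G)} {T : OSData (YMSpecies G) 4} (hT : IsYangMillsFor r sch T)
    {Δ t₀ : ℝ} (ht₀ : 0 < t₀)
    (hdiag : ∀ (n : ℕ), n ≠ 0 → ∀ (σ : Fin n → YMSpecies G)
      (p : Fin n → 𝓢(EuclideanSpace ℝ (Fin 4), ℝ)), IsSlabOrdered p →
      ∃ C : ℝ, ∀ j : ℕ, ∀ ε : ℝ, 0 < ε → ∀ᶠ k in atTop,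
        ‖((latticeSchwinger r.ρ sch (fun s => s.F) k (n + n) (Fin.append (σ ∘ Fin.rev) σ)
              (Fin.append (fun l => thetaTest 4 (p (Fin.rev l)))
                (fun l => translateTest (EuclideanSpace.single 0 ((j : ℝ) * t₀)) (p l))) : ℝ) : ℂ) -
            ((latticeSchwinger r.ρ sch (fun s => s.F) k n (σ ∘ Fin.rev)
                (fun l => thetaTest 4 (p (Fin.rev l))) : ℝ) : ℂ) *
              ((latticeSchwinger r.ρ sch (fun s => s.F) k n σ p : ℝ) : ℂ)‖ ≤
          C * Real.exp (-Δ * ((j : ℝ) * t₀)) + ε) :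
    T.HasMassGap Δ :=
  OSData.hasMassGap_of_tendsto_of_diagBound_progression T (by norm_num)
    (fun k n σ f => ((latticeSchwinger r.ρ sch (fun s => s.F) k n σ f : ℝ) : ℂ)) hT ht₀ hdiag

end YangMills

end Literature.MathematicalPhysics.QuantumFieldTheory

end
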